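import Summits.BirchSwinnertonDyer.Rank1Residual.Supersingular.KobayashiEquivalenceRankZero
import HarnessLib

/-!
# Route `SignedLowerHalves`, crux `KobayashiLowerHalfLargeImage` (item stmt-BirchSwinnertonDyer-19001):
# the binder-FREE unit zone of the Eisenstein half, and the rank-0 slice of the crux = class-wide rank-0
# `BSD(E,p)` on X7 ∧ surj (cell `bsd-ssimc`, seat `bsd-ssimc-k3-c3` gen 3; a `--supports … --as helper`
# file, closes nothing; route-independent: it does not import the Theses file). Companions:
# `…LargeImageReduction.lean` (the line `birth` composed by name), `…LargeImageTwistToLocus.lean`.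

PARTITION (cell bsd-ssimc): X7 (A7) × the large-image branch × odd good supersingular `p` —
types-the-object-of; closes NONE (the unit zone contains no open `BSD(E,p)` cell). THEOREMS ONLY; no
definition, no new named fact; nothing about any curve is asserted; BSD is not proved by any of this.

## What this file records (namespace `Summit.BirchSwinnertonDyer.BirchSwinnertonDyer.Theorems`)

§2 **The unit zone of the Eisenstein half — binder-free, image-free.** If `p` is an odd good prime
with `a_p = 0`, `E[p]` irreducible and `L(E,1)/Ω_E` a `p`-adic unit, then
`KobayashiLowerDivisibility W p ε` for BOTH signs: by Kobayashi (3.6) (PROVED in the tree: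
`IsPollackPair.constantCoeff_kobayashiL`) and the period-unit facts (`h5`, `h3`), `ϖ·L^ε_p` has unit
constant term, so it is a UNIT of `Λ = ℤ_p⟦T⟧` and divides every generator of `char X^ε` (principal:
`charIdeal_isPrincipal_holds`). No Kim, no GZK, no Kobayashi Thm 1.2/4.1, no `BSD(E,p)`, no image
hypothesis. HONEST: this zone contains NO open `BSDp` cell (there the rung needs nothing: the upper
half alone settles `BSD(E,p)`); it is recorded because the crux, as typed, quantifies over it, and as
the Λ-adic counterpart of the cell's «Tamagawa zone» (k3-c5, p421292) and of k3-c4's unit zone for the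
EQUALITY (p418540, which needs `BSD(E,p)` and `#Ш_an ∈ ℤ_p^×` in addition). Image-free, so it serves
item 4's `stub_lowerSmallImage` verbatim on the same zone.

§3 **The rank-0 slice of the crux is class-wide rank-0 `BSD(E,p)` on X7 ∧ surj ∧ `a_p = 0`.** From
the tree's per-pair equivalence `X7.bsdp_iff_kobayashiLowerDivisibility_of_surj_of_analyticRank_eq_zero`
(published inputs by name): `kobayashiLowerHalfLargeImage_rankZero_iff_bsdp`. In rank 0 the Λ-adic
formulation of item 3 loses and gains nothing against the rung's own clause; its excess lies in rank
≥ 1 (where BKO Cor. A.5 needs the equality, supplied from the lower half by Kobayashi Thm 4.1 under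
surjectivity) and in the `∀`-closure over pairs the programme never opens.

References: [Kobayashi2003] Conjecture (p. 2), (3.6) (p. 7), Thm. 1.2, Thm. 4.1; [BDKim2013] Cor. 3.15;
[Wuthrich2014] Prop. 21, Lemma 20; [GreenbergVatsal2000] §3 Rem. 3.4; [Pollack2003] Prop. 6.18;
[Miller2011LMS] Def. 1.1; cell memo k3-c3 MEMO-4 §K.
-/

set_option autoImplicit false
set_option linter.dupNamespace false

noncomputable section

open scoped Classical MatrixGroups ModularForm

open CongruenceSubgroup WeierstrassCurve IsDedekindDomain NumberField Rat.HeightOneSpectrum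
  Literature.NumberTheory.EllipticCurves
  Literature.NumberTheory.EllipticCurves.ModularForms
  Literature.NumberTheory.EllipticCurves.Rank1Residual
  Literature.NumberTheory.EllipticCurves.Rank1Residual.Typed
  Literature.NumberTheory.EllipticCurves.Kobayashi2003 ZpExtension
  Summit.BirchSwinnertonDyer.Rank1Residual.Supersingular

namespace Summit.BirchSwinnertonDyer.BirchSwinnertonDyer.Theorems

/-! ### §2 The unit zone of the Eisenstein half (binder-free, image-free) -/

section UnitZone

variable (W : WeierstrassCurve ℚ) [W.IsElliptic] [W.IsGloballyMinimal] (p : ℕ) [Fact p.Prime]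

/-- **The unit zone: `L(E,1)/Ω_E ∈ ℤ_(p)^×` ⇒ the Eisenstein half of Kobayashi's main conjecture for
BOTH signs, from PUBLISHED inputs only.** Let `p` be an odd prime of good reduction of `E = W` with
`a_p = 0` and `E[p]` irreducible, and suppose `L(E,1)/Ω_E = t ≠ 0` with `ord_p t = 0` (`ht`, `ht0`,
`hv`). Granted BY NAME the period-unit facts (`h5`, `h3`: `ord_p(Ω⁺_f/Ω_E) = 0`):
`KobayashiLowerDivisibility W p ε`. Proof: for any admissible `(κ, γ, f, ϖ, (L⁺,L⁻), D)`,
`char X^ε = (ξ)` is principal (`charIdeal_isPrincipal_holds`); Kobayashi (3.6), PROVED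
(`IsPollackPair.constantCoeff_kobayashiL`), gives `L^ε(0) = c_ε·[0]⁺_f` with `p ∤ c_ε`, and
`ϖ·[0]⁺_f = t`, `ord_p ϖ = 0`, so `L^ε(0) ∈ ℤ_p^×`, `L^ε ∈ Λ^×`; with `ϖ = u ∈ ℤ_p^×` the cofactor
`h := u⁻¹·(L^ε)⁻¹·ξ` satisfies `ι ξ = ϖ·ι(L^ε·h)`. No Kim, no GZK, no Kobayashi Thm 1.2/4.1, no
`BSD(E,p)`, no image hypothesis. HONEST: this zone contains no open `BSD(E,p)` cell of the programme;
PER PAIR; nothing booked. [cite: Kobayashi2003, (3.6) (p. 7) and Conjecture (Main Conjecture) (p. 2)]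
[cite: GreenbergVatsal2000, §3 Remark 3.4] [cite: Pollack2003, Prop. 6.18] -/
theorem kobayashiLowerDivisibility_of_padicValRat_lRatio_eq_zero
    (h5 : realPeriodRat_eq_unit_mul_plusPeriod) (h3 : realPeriodRat_eq_unit_mul_plusPeriod_three)
    (hp : p ≠ 2) (hgood : W.HasGoodReductionAtPrime p) (hap : W.frobeniusTrace p = 0)
    (hirr : Irr W p) {t : ℚ} (ht : W.entireLFunction 1 / (W.realPeriodRat : ℂ) = ((t : ℚ) : ℂ))
    (ht0 : t ≠ 0) (hv : padicValRat p t = 0) (ε : ℤˣ) : KobayashiLowerDivisibility W p ε := by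
  intro κ γ hκ hγ hγ' _ f hf ϖ hϖ Lplus Lminus hPP D
  -- a generator `ξ` of `char X^ε`
  obtain ⟨ξ, hξ⟩ := (charIdeal_isPrincipal_holds p D.X).principal
  have hξ' : D.charIdeal = Ideal.span {ξ} := hξ
  set L := kobayashiL ε Lplus Lminus with hL_def
  -- `t = ϖ · [0]⁺_f`
  set s : ℚ := ratPlusSymbol f 0 with hs_def
  have hΩpos : 0 < W.realPeriodRat := W.realPeriodRat_pos_holds
  have hLval : W.entireLFunction 1 = (((s : ℝ) * plusPeriod f : ℝ) : ℂ) := hf.entireLFunction_one_eq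
  have hts : ((t : ℚ) : ℂ) = (((ϖ * s : ℚ)) : ℂ) := by
    rw [← ht, hLval, ← hϖ, div_eq_iff (Complex.ofReal_ne_zero.mpr hΩpos.ne')]
    push_cast
    ring
  have htϖs : t = ϖ * s := by exact_mod_cast hts
  have hϖ0 : ϖ ≠ 0 := by
    rintro rfl
    rw [zero_mul] at htϖs
    exact ht0 htϖs
  have hs0 : s ≠ 0 := by
    intro h0
    rw [h0, mul_zero] at htϖs
    exact ht0 htϖs
  -- `ord_p ϖ = 0` (period-unit facts), hence `ord_p s = 0`
  have hvϖ : padicValRat p ϖ = 0 := padicValRat_periodRatio_eq_zero h5 h3 W p hp hgood hirr f hf ϖ hϖ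
  have hvs : padicValRat p s = 0 := by
    have h1 : padicValRat p t = padicValRat p ϖ + padicValRat p s := by
      rw [htϖs, padicValRat.mul hϖ0 hs0]
    rw [hv, hvϖ, zero_add] at h1
    exact h1.symm
  -- (3.6): `L(0) = c_ε · s`, a `p`-adic unit; so `L ∈ Λ^×`
  have hLε := hPP.constantCoeff_kobayashiL hp hf hgood hap ε
  have hcne : kobayashiConst p ε ≠ 0 := fun hz ↦
    not_dvd_kobayashiConst hp ε (by rw [hz]; exact dvd_zero p)
  have hc0 : (kobayashiConst p ε : ℚ_[p]) ≠ 0 := by exact_mod_cast hcne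
  have hsQ0 : ((s : ℚ) : ℚ_[p]) ≠ 0 := by exact_mod_cast hs0
  have hL0ne : ((PowerSeries.constantCoeff L : ℤ_[p]) : ℚ_[p]) ≠ 0 := by
    rw [hLε]; exact mul_ne_zero hc0 hsQ0
  have hvL : (((PowerSeries.constantCoeff L : ℤ_[p]) : ℚ_[p])).valuation = 0 := by
    rw [hLε, Padic.valuation_mul hc0 hsQ0, Padic.valuation_natCast,
      padicValNat.eq_zero_of_not_dvd (not_dvd_kobayashiConst hp ε), Padic.valuation_ratCast, hvs]
    simp
  have hLu : IsUnit L := by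
    refine PowerSeries.isUnit_iff_constantCoeff.mpr (PadicInt.isUnit_iff.mpr ?_)
    rw [← PadicInt.padic_norm_e_of_padicInt, Padic.norm_eq_zpow_neg_valuation hL0ne, hvL,
      neg_zero, zpow_zero]
  -- `ϖ = u ∈ ℤ_p^×`; cofactor `h := u⁻¹ · L⁻¹ · ξ`
  obtain ⟨u, hu⟩ := exists_units_coe_eq_ratCast hϖ0 hvϖ
  obtain ⟨-, hιC⟩ := span_C_units_mul_eq u⁻¹ ξ
  refine ⟨ξ, PowerSeries.C ((u⁻¹ : ℤ_[p]ˣ) : ℤ_[p]) * ↑(hLu.unit⁻¹) * ξ, hξ', ?_⟩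
  have hLh : L * (PowerSeries.C ((u⁻¹ : ℤ_[p]ˣ) : ℤ_[p]) * ↑(hLu.unit⁻¹) * ξ) =
      PowerSeries.C ((u⁻¹ : ℤ_[p]ˣ) : ℤ_[p]) * ξ := by
    calc L * (PowerSeries.C ((u⁻¹ : ℤ_[p]ˣ) : ℤ_[p]) * ↑(hLu.unit⁻¹) * ξ)
        = PowerSeries.C ((u⁻¹ : ℤ_[p]ˣ) : ℤ_[p]) * (L * ↑(hLu.unit⁻¹)) * ξ := by ring
      _ = PowerSeries.C ((u⁻¹ : ℤ_[p]ˣ) : ℤ_[p]) * ξ := by rw [IsUnit.mul_val_inv, mul_one]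
  rw [hLh, hιC, ← mul_assoc, ← map_mul, ← hu, ← PadicInt.coe_mul, ← Units.val_mul, mul_inv_cancel,
    Units.val_one, PadicInt.coe_one, map_one, one_mul]

/-- **X7 reading of the unit zone.** On class X7 at an odd `p` with `a_p = 0` (irreducibility is
automatic: `ClassX7.irr`), `L(E,1)/Ω_E ∈ ℤ_(p)^×` gives the crux's conclusion
`∃ ε, KobayashiLowerDivisibility W p ε` (indeed both signs) with NO binder and NO image hypothesis —
so it also serves item 4's `stub_lowerSmallImage` on the same zone. PER PAIR; closes no open cell.
[cite: Kobayashi2003, (3.6) (p. 7) and Conjecture (Main Conjecture) (p. 2)]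
[cite: GreenbergVatsal2000, §3 Remark 3.4] -/
theorem X7_kobayashiLowerDivisibility_of_padicValRat_lRatio_eq_zero
    (h5 : realPeriodRat_eq_unit_mul_plusPeriod) (h3 : realPeriodRat_eq_unit_mul_plusPeriod_three)
    (hp : p ≠ 2) (hX : ClassX7 W p) (hap : W.frobeniusTrace p = 0)
    {t : ℚ} (ht : W.entireLFunction 1 / (W.realPeriodRat : ℂ) = ((t : ℚ) : ℂ))
    (ht0 : t ≠ 0) (hv : padicValRat p t = 0) :
    ∃ ε : ℤˣ, KobayashiLowerDivisibility W p ε :=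
  ⟨1, kobayashiLowerDivisibility_of_padicValRat_lRatio_eq_zero W p h5 h3 hp hX.1.1 hap
    (ClassX7.irr W p hp hX) ht ht0 hv 1⟩

end UnitZone

/-! ### §3 The rank-0 slice of the crux is class-wide rank-0 `BSD(E,p)` on X7 ∧ surj -/

section RankZero

/-- **Item 3 restricted to analytic rank 0 ⟺ class-wide rank-0 `BSD(E,p)` on X7 ∧ surj(p) ∧ `a_p = 0`**,
granted the PUBLISHED inputs by name (Wuthrich 2014 Prop. 21 `hW` and Lemma 20 `hL20`, Kobayashi
2003 Thms 1.2/4.1 `h12`/`h41`, B. D. Kim 2013 Cor. 3.15 `hKim`, Pollack `hPollack`, modularity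
`hmodP`/`hmod'`, GZK `hGZK`, the period-unit facts `h5`/`h3`): the per-pair equivalence
`X7.bsdp_iff_kobayashiLowerDivisibility_of_surj_of_analyticRank_eq_zero` (lower half ⇒ `BSD(E,p)` by
the ± road; `BSD(E,p)` ⇒ main conjecture by the integral converse under surjectivity), quantified over
the class. So the Λ-adic wording of the crux costs nothing and gains nothing in rank 0; its excess over
the rung lies entirely in rank ≥ 1 and in the `∀`-closure over pairs the programme never opens.
[cite: Kobayashi2003, Thm. 1.2, Thm. 4.1 and Conjecture (p. 2)] [cite: BDKim2013, Cor. 3.15 (p. 199)]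
[cite: Wuthrich2014, Prop. 21 (p. 400) and Lemma 20 (p. 399)] [cite: Miller2011LMS, Def. 1.1] -/
theorem kobayashiLowerHalfLargeImage_rankZero_iff_bsdp
    (hW : Wuthrich2014.sha_dvd_analyticSha)
    (h12 : Kobayashi2003.thm12_signedSelmerDual_finite_torsion)
    (h41 : Kobayashi2003.thm41_signedCharIdeal_divisibility)
    (hKim : BDKim2013.cor315_signedCharValue_rankZero)
    (hPollack : ∀ (W : WeierstrassCurve ℚ) [W.IsElliptic] [W.IsGloballyMinimal] (p : ℕ) [Fact p.Prime]
      {N : ℕ} [NeZero N] {f : CuspForm (Gamma0 N) 2},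
      pollack_exists_plusMinusPAdicLFunction (W := W) (f := f) (p := p))
    (hmodP : nonempty_modularParametrizationData) (hmod' : hasEntireLFunction_rat)
    (hGZK : rank_eq_analyticRank_of_analyticRank_le_one)
    (h5 : realPeriodRat_eq_unit_mul_plusPeriod) (h3 : realPeriodRat_eq_unit_mul_plusPeriod_three)
    (hL20 : Wuthrich2014.lemma20_surjective_threeAdic_of_semistable) :
    (∀ (W : WeierstrassCurve ℚ) [W.IsElliptic] [W.IsGloballyMinimal] (p : ℕ) [Fact p.Prime],
      p ≠ 2 → ClassX7 W p → ¬ W.HasCM → W.frobeniusTrace p = 0 → Surj W p → W.analyticRank = 0 →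
      ∃ ε : ℤˣ, KobayashiLowerDivisibility W p ε) ↔
    (∀ (W : WeierstrassCurve ℚ) [W.IsElliptic] [W.IsGloballyMinimal] (p : ℕ) [Fact p.Prime],
      p ≠ 2 → ClassX7 W p → ¬ W.HasCM → W.frobeniusTrace p = 0 → Surj W p → W.analyticRank = 0 →
      BSDp W p) := by
  constructor
  · intro h W _ _ p _ hp hX hcm hap hs h0
    obtain ⟨ε, hε⟩ := h W p hp hX hcm hap hs h0
    exact (X7.bsdp_iff_kobayashiLowerDivisibility_of_surj_of_analyticRank_eq_zero W p hW h12 h41 hKim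
      (hPollack W p) hmodP hmod' hGZK h5 h3 hL20 hp hX hap hs h0 ε).mpr hε
  · intro h W _ _ p _ hp hX hcm hap hs h0
    exact ⟨1, (X7.bsdp_iff_kobayashiLowerDivisibility_of_surj_of_analyticRank_eq_zero W p hW h12 h41
      hKim (hPollack W p) hmodP hmod' hGZK h5 h3 hL20 hp hX hap hs h0 1).mp (h W p hp hX hcm hap hs h0)⟩

end RankZero

end Summit.BirchSwinnertonDyer.BirchSwinnertonDyer.Theorems

end
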